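import Mathlib.Algebra.Homology.Bifunctor
import Mathlib.Algebra.Homology.ShortComplex.HomologicalComplex
import HarnessLib

/-!
# Complexes with zero differentials: homology, and the Künneth formula for their bifunctor total complex

Layer `Literature/Algebra/Homology` (pure homological algebra over Mathlib; one definition, 0 named facts, no instances, no
notation). The first, formal rung of the algebraic Künneth theorem (Weibel, *An introduction to homological algebra*,
Thm. 3.6.3; Cartan–Eilenberg VI.3.1): if two complexes `K₁`, `K₂` have ZERO differentials, then so does the total complex
`mapBifunctor K₁ K₂ F c` of any bifunctor `F` additive in each variable (Mathlib `HomologicalComplex.mapBifunctor`, e.g. the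
tensor product of complexes), and therefore

  `Hʲ(mapBifunctor K₁ K₂ F c) ≅ (mapBifunctor K₁ K₂ F c).X j = ∐_{π(i₁,i₂)=j} F(K₁^{i₁}, K₂^{i₂})`.

Over a field every complex is quasi-isomorphic to such a complex (its homology with zero differentials), which is how the
Künneth formula `Hⁿ(C ⊗ D) ≅ ⨁_{i+j=n} Hⁱ(C) ⊗ Hʲ(D)` is reduced to this file.

* `zeroDifferential c G` — the complex with terms `G : I → V` and all differentials `0` (the ONLY definition; every
  isomorphism below is stated as `Nonempty (… ≅ …)`);
* `nonempty_homologyIsoX_of_d_eq_zero : Nonempty (K.homology i ≅ K.X i)` for a complex all of whose differentials vanish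
  (Mathlib `ShortComplex.LeftHomologyData.ofZeros`); `nonempty_zeroDifferential_homologyIso`;
* `mapBifunctor_d_eq_zero` — `mapBifunctor K₁ K₂ F c` has zero differentials when `K₁`, `K₂` do;
* **`nonempty_mapBifunctor_homologyIsoX`** — `(mapBifunctor K₁ K₂ F c).homology j ≅ (mapBifunctor K₁ K₂ F c).X j` (the
  coproduct of the `F(K₁^{i₁}, K₂^{i₂})`, `π(i₁, i₂) = j`) for complexes with zero differentials.

## References

* C. A. Weibel, *An introduction to homological algebra* (1994), Thm. 3.6.3 (Künneth formula for complexes), 1.2.6 (total complex). [Weibel1994]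
* H. Cartan, S. Eilenberg, *Homological Algebra* (1956), VI.3, Thm. 3.1. [CartanEilenberg1956]
-/

noncomputable section

-- `GradedObject`/`HomologicalComplex₂.toGradedObject` are not reducible (as in Mathlib's `Algebra/Homology/TotalComplex.lean`).
set_option backward.isDefEq.respectTransparency false

open CategoryTheory CategoryTheory.Category CategoryTheory.Limits HomologicalComplex

universe v₁ v₂ v₃ u₁ u₂ u₃

namespace Literature.Algebra.Homology

/-! ### §1 Complexes with zero differentials and their homology -/

section ZeroDifferential

variable {V : Type u₁} [Category.{v₁} V] [HasZeroMorphisms V] {I : Type*} (c : ComplexShape I)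

/-- **The complex with zero differentials** on a family of objects `G : I → V` (a graded object viewed as a complex;
e.g. the homology `i ↦ Hⁱ(C)` of a complex). [cite: Weibel1994, 1.2.6 and Thm. 3.6.3] -/
def zeroDifferential (G : I → V) : HomologicalComplex V c where
  X := G
  d _ _ := 0
  shape _ _ _ := rfl
  d_comp_d' _ _ _ _ _ := by simp

/-- The terms of `zeroDifferential c G` are the `G i`. [cite: Weibel1994, 1.2.6 and Thm. 3.6.3] -/
@[simp]
theorem zeroDifferential_X (G : I → V) (i : I) : (zeroDifferential c G).X i = G i := rfl

/-- The differentials of `zeroDifferential c G` vanish. [cite: Weibel1994, 1.2.6 and Thm. 3.6.3] -/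
@[simp]
theorem zeroDifferential_d (G : I → V) (i j : I) : (zeroDifferential c G).d i j = 0 := rfl

variable {c}

/-- **A complex all of whose differentials vanish is its own homology**: `Hⁱ(K) ≅ Kⁱ` (Mathlib's homology data
`ShortComplex.LeftHomologyData.ofZeros` of the short complex `K^{prev} → Kⁱ → K^{next}` with both maps zero).
[cite: Weibel1994, Thm. 3.6.3 (proof)] -/
theorem nonempty_homologyIsoX_of_d_eq_zero [CategoryWithHomology V] (K : HomologicalComplex V c)
    (hK : ∀ i j, K.d i j = 0) (i : I) : Nonempty (K.homology i ≅ K.X i) :=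
  ⟨(ShortComplex.LeftHomologyData.ofZeros (K.sc i) (hK _ _) (hK _ _)).homologyIso⟩

/-- `Hⁱ(zeroDifferential c G) ≅ G i`. [cite: Weibel1994, Thm. 3.6.3 (proof)] -/
theorem nonempty_zeroDifferential_homologyIso [CategoryWithHomology V] (G : I → V) (i : I) :
    Nonempty ((zeroDifferential c G).homology i ≅ G i) :=
  nonempty_homologyIsoX_of_d_eq_zero (zeroDifferential c G) (fun _ _ => rfl) i

end ZeroDifferential

/-! ### §2 The total complex of a bifunctor applied to complexes with zero differentials -/

section MapBifunctor

variable {C₁ : Type u₁} {C₂ : Type u₂} {D : Type u₃} [Category.{v₁} C₁] [Category.{v₂} C₂] [Category.{v₃} D]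
  [HasZeroMorphisms C₁] [HasZeroMorphisms C₂] [Preadditive D]
  {I₁ I₂ J : Type*} {c₁ : ComplexShape I₁} {c₂ : ComplexShape I₂}
  (K₁ : HomologicalComplex C₁ c₁) (K₂ : HomologicalComplex C₂ c₂)
  (F : C₁ ⥤ C₂ ⥤ D) [F.PreservesZeroMorphisms] [∀ X₁, (F.obj X₁).PreservesZeroMorphisms]
  (c : ComplexShape J) [TotalComplexShape c₁ c₂ c] [DecidableEq J] [HasMapBifunctor K₁ K₂ F c]

/-- **If `K₁` and `K₂` have zero differentials, so does `mapBifunctor K₁ K₂ F c`** (both components `D₁`, `D₂` of the total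
differential are sums of terms through `F(d₁, –) = 0` and `F(–, d₂) = 0`). [cite: Weibel1994, Thm. 3.6.3 (proof)] -/
theorem mapBifunctor_d_eq_zero (h₁ : ∀ i i', K₁.d i i' = 0) (h₂ : ∀ i i', K₂.d i i' = 0) (j j' : J) :
    (mapBifunctor K₁ K₂ F c).d j j' = 0 := by
  rw [mapBifunctor.d_eq]
  have hD₁ : mapBifunctor.D₁ K₁ K₂ F c j j' = 0 := by
    refine mapBifunctor.hom_ext fun i₁ i₂ hij => ?_
    rw [mapBifunctor.ι_D₁, comp_zero]
    by_cases hi : c₁.Rel i₁ (c₁.next i₁)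
    · rw [mapBifunctor.d₁_eq' K₁ K₂ F c hi i₂ j', h₁, Functor.map_zero, zero_app, zero_comp, smul_zero]
    · exact mapBifunctor.d₁_eq_zero K₁ K₂ F c i₁ i₂ j' hi
  have hD₂ : mapBifunctor.D₂ K₁ K₂ F c j j' = 0 := by
    refine mapBifunctor.hom_ext fun i₁ i₂ hij => ?_
    rw [mapBifunctor.ι_D₂, comp_zero]
    by_cases hi : c₂.Rel i₂ (c₂.next i₂)
    · rw [mapBifunctor.d₂_eq' K₁ K₂ F c i₁ hi j', h₂, Functor.map_zero, zero_comp, smul_zero]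
    · exact mapBifunctor.d₂_eq_zero K₁ K₂ F c i₁ i₂ j' hi
  rw [hD₁, hD₂, add_zero]

/-- **Künneth formula for complexes with zero differentials**: `Hʲ(mapBifunctor K₁ K₂ F c) ≅ (mapBifunctor K₁ K₂ F c).X j`, the
coproduct of the `F(K₁^{i₁}, K₂^{i₂})` over `π(i₁, i₂) = j` (e.g. `Hʲ(G₁ ⊗ G₂) = ⨁_{i₁+i₂=j} G₁^{i₁} ⊗ G₂^{i₂}` for graded objects
viewed as complexes). [cite: Weibel1994, Thm. 3.6.3] [cite: CartanEilenberg1956, VI.3 Thm. 3.1] -/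
theorem nonempty_mapBifunctor_homologyIsoX [CategoryWithHomology D] (h₁ : ∀ i i', K₁.d i i' = 0)
    (h₂ : ∀ i i', K₂.d i i' = 0) (j : J) :
    Nonempty ((mapBifunctor K₁ K₂ F c).homology j ≅ (mapBifunctor K₁ K₂ F c).X j) :=
  nonempty_homologyIsoX_of_d_eq_zero _ (mapBifunctor_d_eq_zero K₁ K₂ F c h₁ h₂) j

/-- The case of two `zeroDifferential` complexes: `Hʲ(mapBifunctor (G₁, 0) (G₂, 0)) ≅ (its degree-`j` term)`, the coproduct
`∐_{π(i₁,i₂)=j} F(G₁ i₁, G₂ i₂)`. [cite: Weibel1994, Thm. 3.6.3] -/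
theorem nonempty_zeroDifferential_mapBifunctor_homologyIso [CategoryWithHomology D] (G₁ : I₁ → C₁) (G₂ : I₂ → C₂)
    [HasMapBifunctor (zeroDifferential c₁ G₁) (zeroDifferential c₂ G₂) F c] (j : J) :
    Nonempty ((mapBifunctor (zeroDifferential c₁ G₁) (zeroDifferential c₂ G₂) F c).homology j ≅
      (mapBifunctor (zeroDifferential c₁ G₁) (zeroDifferential c₂ G₂) F c).X j) :=
  nonempty_mapBifunctor_homologyIsoX _ _ F c (fun _ _ => rfl) (fun _ _ => rfl) j

end MapBifunctor

end Literature.Algebra.Homology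

end
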